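import Mathlib.Analysis.Calculus.ContDiff.Basic
import Mathlib.Analysis.Calculus.ContDiff.Operations
import Mathlib.Analysis.InnerProductSpace.Calculus
import Mathlib.Analysis.InnerProductSpace.PiL2
import HarnessLib

/-!
# `k`-convexity of a level hypersurface, in Ky Fan (trace-over-frames) form

Topic `Geometry/Riemannian`; definition item `defn-IsKConvexLevelSet` (route
`SmoothPoincare4/ConvexityLadder`, items stmt-SmoothPoincare4-4785/4787/4788/4789/4791, which
restate the notion inline).

## Sources (read: Harvey–Lawson arXiv:1111.3895 §§2–3, chunk p. 4)

* F. R. Harvey, H. B. Lawson, *p-convexity, p-plurisubharmonicity and the Levi problem*, Indiana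
  Univ. Math. J. 62 (2013) = arXiv:1111.3895, **§3, Def. 3.8**: the smooth boundary `∂Ω` is
  `p`-convex at `x` if `tr_W II_{∂Ω} ≥ 0` for all tangential `p`-planes `W ⊆ T_x ∂Ω` (`II` w.r.t.
  the inward normal); **Remark 3.11** (local defining functions): if `∂Ω ∩ B = {ρ = 0}`,
  `Ω ∩ B = {ρ < 0}`, `dρ ≠ 0`, then `D²ρ = |∇ρ| II` on tangent vectors, so `∂Ω` is `p`-convex at
  `x` iff `tr_W D²_x ρ ≥ 0` for all `p`-planes `W` tangent to `∂Ω` at `x`, independently of the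
  defining function; **Remark 3.12**: iff `κ₁ + ⋯ + κ_p ≥ 0` for the ordered principal curvatures
  (Cor. 2.6, the Ky Fan principle: `inf_W tr_W A = λ₁(A) + ⋯ + λ_p(A)`); §2 (1)–(2): `tr_W A` is the
  trace of `A|_W`.
* J.-P. Sha, *p-convex Riemannian manifolds*, Invent. Math. 83 (1986), §1 (the notion, sums of `p`
  principal curvatures) [Sha1986]; G. Huisken, C. Sinestrari, *Mean curvature flow with surgeries
  of two-convex hypersurfaces*, Invent. Math. 175 (2009), §1: two-convex `:⟺ λ₁ + λ₂ > 0`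
  (strict) [HuiskenSinestrari2008].

## What is defined

For a real inner product space `E` (the consumers take `E = EuclideanSpace ℝ (Fin n)`), a function
`F : E → ℝ` and a point `x`:

* `hessianFrameTrace F x v = Σᵢ D²F(x)[vᵢ, vᵢ]` — for an orthonormal frame `v` of a plane `W`
  this is `tr_W D²_x F` (§2 (1));
* `IsKConvexLevelSetAt k F x`: for every orthonormal `k`-frame `v` in `ker DF(x)` (the tangent
  space of the level set `{F = F x}` at a regular point), `0 < Σᵢ D²F(x)[vᵢ, vᵢ]` — the **strict**
  form (Huisken–Sinestrari, and the route's inline statements) of Harvey–Lawson's Def. 3.8 read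
  through Remark 3.11 for the domain `Ω = {F ≤ 0}` with defining function `F` (inward normal
  `-∇F/|∇F|`): the sum of the `k` smallest principal curvatures of `{F = 0}` is positive; `k = 1`:
  strictly convex, `k = 2`: two-convex, `k = n - 1`: strictly mean-convex;
* `IsKConvexLevelSet k F`: `IsKConvexLevelSetAt k F x` at every point of the zero level `{F = 0}`.

Regularity (`DF(x) ≠ 0`) is NOT part of the predicate — the consumers carry it separately, as in
the item; at a critical point the condition constrains all orthonormal `k`-frames.

## API proved

`IsKConvexLevelSetAt.succ` / `.mono` (monotone in `k ≥ 1`, by averaging over the `k + 1`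
sub-frames of a `(k+1)`-frame — the trace form of `λ_{k+1} ≥ λ_k`), invariance under translations
(`isKConvexLevelSetAt_comp_add_right_iff`) and linear isometries
(`isKConvexLevelSetAt_comp_linearIsometryEquiv_iff`) — i.e. under rigid motions —, under
multiplication by a positive constant (`IsKConvexLevelSetAt.const_mul`), and the round sphere:
`isKConvexLevelSet_norm_sq_sub` (`F = ‖·‖² - r²` is `k`-convex for every `k ≥ 1`, each term being
`D²F[v, v] = 2‖v‖² = 2`).

## Not here

The eigenvalue formulation and its equivalence with the trace form (Ky Fan minimum principle,
Harvey–Lawson Cor. 2.6; Mathlib has Courant–Fischer only in pieces); invariance under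
`F ↦ φ ∘ F` for increasing `φ` with `φ(0) = 0`, `φ'(0) > 0` (second-order chain rule); the weak
(`≥ 0`) variant of Harvey–Lawson. `k = 0` makes `IsKConvexLevelSetAt 0 F x` false (empty frame,
`0 < 0`); if `dim ker DF(x) < k` the condition is vacuous.
-/

noncomputable section

open scoped BigOperators InnerProductSpace
open Set Function

namespace Literature.Geometry.Riemannian

variable {E : Type*} [NormedAddCommGroup E] [InnerProductSpace ℝ E]

/-- The **trace of the Hessian over a frame**: `Σᵢ D²F(x)[vᵢ, vᵢ]`; for an orthonormal frame `v` of
a `k`-plane `W` this is `tr_W D²_x F`, the trace of the restriction of the Hessian to `W`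
(Harvey–Lawson §2 (1)). [cite: HarveyLawson2013PConvexity, §2 (1) (the W-trace)] -/
def hessianFrameTrace (F : E → ℝ) (x : E) {k : ℕ} (v : Fin k → E) : ℝ :=
  ∑ i, iteratedFDeriv ℝ 2 F x ![v i, v i]

/-- Unfolding the frame trace. [folklore] -/
theorem hessianFrameTrace_def (F : E → ℝ) (x : E) {k : ℕ} (v : Fin k → E) :
    hessianFrameTrace F x v = ∑ i, iteratedFDeriv ℝ 2 F x ![v i, v i] := rfl

/-- **`k`-convexity of the level set of `F` at `x` (strict, Ky Fan form).** For every orthonormal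
`k`-frame `v₁, …, v_k` of vectors tangent to the level set at `x` (`DF(x) vᵢ = 0`), the trace of the
Hessian over the frame is positive: `0 < Σᵢ D²F(x)[vᵢ, vᵢ]`. At a regular point of `{F = 0}` this
says (Harvey–Lawson 2013, Def. 3.8 with Remark 3.11, `D²ρ = |∇ρ|·II` for the defining function
`ρ = F` of `Ω = {F ≤ 0}`, and Remark 3.12) that the sum of the `k` smallest principal curvatures of
the hypersurface `{F = 0}` with respect to the inward normal `-∇F/|∇F|` is positive — the strict
version used by Huisken–Sinestrari (two-convex: `λ₁ + λ₂ > 0`) and by route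
`SmoothPoincare4/ConvexityLadder`; `k = 1` strictly convex, `k = 2` two-convex, `k = n-1` strictly
mean-convex (Sha 1986, §1). [cite: HarveyLawson2013PConvexity, Def. 3.8, Remark 3.11 (3.3), Remark 3.12] -/
def IsKConvexLevelSetAt (k : ℕ) (F : E → ℝ) (x : E) : Prop :=
  ∀ v : Fin k → E, Orthonormal ℝ v → (∀ i, fderiv ℝ F x (v i) = 0) →
    0 < ∑ i, iteratedFDeriv ℝ 2 F x ![v i, v i]

/-- **`k`-convexity of the zero level set of `F`**: `k`-convex at every point of `{F = 0}`
(Harvey–Lawson 2013, Def. 3.8: "`∂Ω` is `p`-convex if it is `p`-convex at every point"; strict form).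
[cite: HarveyLawson2013PConvexity, Def. 3.8] -/
def IsKConvexLevelSet (k : ℕ) (F : E → ℝ) : Prop :=
  ∀ x, F x = 0 → IsKConvexLevelSetAt k F x

/-- Unfolding `IsKConvexLevelSetAt` through the frame trace. [folklore] -/
theorem isKConvexLevelSetAt_iff (k : ℕ) (F : E → ℝ) (x : E) :
    IsKConvexLevelSetAt k F x ↔ ∀ v : Fin k → E, Orthonormal ℝ v →
      (∀ i, fderiv ℝ F x (v i) = 0) → 0 < hessianFrameTrace F x v :=
  Iff.rfl

/-- With `k = 0` the condition fails (the empty frame has trace `0`). [folklore] -/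
theorem not_isKConvexLevelSetAt_zero (F : E → ℝ) (x : E) : ¬ IsKConvexLevelSetAt 0 F x := by
  intro h
  have := h (fun i => Fin.elim0 i) ⟨fun i => Fin.elim0 i, fun i => Fin.elim0 i⟩
    (fun i => Fin.elim0 i)
  simp at this

/-! ### Monotonicity in `k` -/

/-- **`k`-convex ⇒ `(k+1)`-convex** (`k ≥ 1`): summing the (positive) traces over the `k + 1`
sub-frames `v ∘ j.succAbove` of an orthonormal `(k+1)`-frame `v` gives `k · Σᵢ D²F[vᵢ, vᵢ] > 0`.
This is the trace form of `λ₁ + ⋯ + λ_k > 0 ⇒ λ_{k+1} ≥ λ_k > 0` (Harvey–Lawson Remark 3.12).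
[folklore] -/
theorem IsKConvexLevelSetAt.succ {k : ℕ} (hk : 1 ≤ k) {F : E → ℝ} {x : E}
    (h : IsKConvexLevelSetAt k F x) : IsKConvexLevelSetAt (k + 1) F x := by
  intro v hv hker
  set Q : Fin (k + 1) → ℝ := fun l => iteratedFDeriv ℝ 2 F x ![v l, v l] with hQ
  -- each sub-frame omitting `j` is orthonormal and tangent, hence has positive trace `S - Q j`
  have hsub : ∀ j : Fin (k + 1), 0 < (∑ l, Q l) - Q j := by
    intro j
    have horth : Orthonormal ℝ (v ∘ j.succAbove) := hv.comp _ Fin.succAbove_right_injective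
    have hpos := h (v ∘ j.succAbove) horth fun i => hker _
    have hsplit : ∑ l, Q l = Q j + ∑ i, Q (j.succAbove i) := Fin.sum_univ_succAbove Q j
    simp only [Function.comp_apply] at hpos
    linarith
  -- sum over `j`: `(k+1) S - S = k S > 0`
  have hsum : 0 < ∑ j : Fin (k + 1), ((∑ l, Q l) - Q j) := Finset.sum_pos (fun j _ => hsub j)
    Finset.univ_nonempty
  have hcalc : ∑ j : Fin (k + 1), ((∑ l, Q l) - Q j) = k * ∑ l, Q l := by
    rw [Finset.sum_sub_distrib, Finset.sum_const, Finset.card_univ, Fintype.card_fin]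
    simp only [nsmul_eq_mul, Nat.cast_add, Nat.cast_one]
    ring
  rw [hcalc] at hsum
  have hk' : (0 : ℝ) < k := by exact_mod_cast hk
  exact (mul_pos_iff_of_pos_left hk').1 hsum

/-- **Monotonicity in `k`**: for `1 ≤ k ≤ l`, `k`-convex at `x` implies `l`-convex at `x`.
[folklore] -/
theorem IsKConvexLevelSetAt.mono {k l : ℕ} (hk : 1 ≤ k) (hkl : k ≤ l) {F : E → ℝ} {x : E}
    (h : IsKConvexLevelSetAt k F x) : IsKConvexLevelSetAt l F x := by
  induction l, hkl using Nat.le_induction with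
  | base => exact h
  | succ l hkl ih => exact ih.succ (hk.trans hkl)

/-- Monotonicity in `k` on the whole level set. [folklore] -/
theorem IsKConvexLevelSet.mono {k l : ℕ} (hk : 1 ≤ k) (hkl : k ≤ l) {F : E → ℝ}
    (h : IsKConvexLevelSet k F) : IsKConvexLevelSet l F :=
  fun x hx => (h x hx).mono hk hkl

/-! ### Invariance under rigid motions and positive rescaling -/

/-- **Translation invariance**: `x ↦ F (x + a)` is `k`-convex at `x` iff `F` is at `x + a`.
[folklore] -/
theorem isKConvexLevelSetAt_comp_add_right_iff (k : ℕ) (F : E → ℝ) (a x : E) :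
    IsKConvexLevelSetAt k (fun y => F (y + a)) x ↔ IsKConvexLevelSetAt k F (x + a) := by
  simp only [IsKConvexLevelSetAt, iteratedFDeriv_comp_add_right, fderiv_comp_add_right]

/-- **Isometry invariance**: for a linear isometry `e : E' ≃ E`, `F ∘ e` is `k`-convex at `y` iff
`F` is at `e y` (frames are transported by `e`). [folklore] -/
theorem isKConvexLevelSetAt_comp_linearIsometryEquiv_iff {E' : Type*} [NormedAddCommGroup E']
    [InnerProductSpace ℝ E'] (k : ℕ) (F : E → ℝ) (e : E' ≃ₗᵢ[ℝ] E) (y : E') :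
    IsKConvexLevelSetAt k (F ∘ e) y ↔ IsKConvexLevelSetAt k F (e y) := by
  have hD2 : ∀ v : E', iteratedFDeriv ℝ 2 (F ∘ e) y ![v, v] =
      iteratedFDeriv ℝ 2 F (e y) ![e v, e v] := by
    intro v
    have h := (e.toContinuousLinearEquiv).iteratedFDerivWithin_comp_right F uniqueDiffOn_univ
      (mem_univ (e.toContinuousLinearEquiv y)) 2
    simp only [preimage_univ, iteratedFDerivWithin_univ] at h
    change iteratedFDeriv ℝ 2 (F ∘ e.toContinuousLinearEquiv) y ![v, v] = _
    rw [h, ContinuousMultilinearMap.compContinuousLinearMap_apply]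
    congr 1
    funext i
    fin_cases i <;> rfl
  have hD1 : ∀ v : E', fderiv ℝ (F ∘ e) y v = fderiv ℝ F (e y) (e v) := by
    intro v
    change fderiv ℝ (F ∘ e.toContinuousLinearEquiv) y v = _
    rw [e.toContinuousLinearEquiv.comp_right_fderiv]
    rfl
  constructor
  · intro h v hv hker
    have h' := h (e.symm ∘ v) (hv.comp_linearIsometryEquiv e.symm) (fun i => by
      rw [Function.comp_apply, hD1, e.apply_symm_apply]; exact hker i)
    simpa only [Function.comp_apply, hD2, e.apply_symm_apply] using h'
  · intro h v hv hker
    have h' := h (e ∘ v) (hv.comp_linearIsometryEquiv e) (fun i => by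
      rw [Function.comp_apply, ← hD1]; exact hker i)
    simpa only [Function.comp_apply, hD2] using h'

/-- **Positive rescaling**: if `F` is `C²` at `x`, then `c · F`, `c > 0`, is `k`-convex at `x` iff `F`
is. [folklore] -/
theorem isKConvexLevelSetAt_const_mul_iff (k : ℕ) {F : E → ℝ} {x : E} {c : ℝ} (hc : 0 < c)
    (hF : ContDiffAt ℝ 2 F x) :
    IsKConvexLevelSetAt k (fun y => c * F y) x ↔ IsKConvexLevelSetAt k F x := by
  have h2 : ∀ v : E, iteratedFDeriv ℝ 2 (fun y => c * F y) x ![v, v] =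
      c * iteratedFDeriv ℝ 2 F x ![v, v] := by
    intro v
    have := iteratedFDeriv_const_smul_apply (a := c) hF (x := x)
    change iteratedFDeriv ℝ 2 (c • F) x ![v, v] = _
    rw [this]
    rfl
  have h1 : ∀ v : E, fderiv ℝ (fun y => c * F y) x v = c * fderiv ℝ F x v := by
    intro v
    have hd : DifferentiableAt ℝ F x := hF.differentiableAt (by norm_num)
    rw [show (fun y => c * F y) = c • F from rfl, fderiv_const_smul hd]
    rfl
  simp only [IsKConvexLevelSetAt, h1, h2, mul_eq_zero, hc.ne', false_or, ← Finset.mul_sum,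
    mul_pos_iff_of_pos_left hc]

/-! ### The round sphere -/

/-- Over `ℝ` the inner-product map `innerSL` is a genuine continuous bilinear map; evaluating its
linear coercion (cf. `Literature.Analysis.FluidPDE.innerSL_real_coe_apply_apply`). [folklore] -/
theorem innerSL_real_coe_apply_apply' (a v : E) :
    ((innerSL ℝ : E →L[ℝ] E →L[ℝ] ℝ) a) v = ⟪a, v⟫_ℝ := rfl

/-- The gradient of `x ↦ ‖x‖² - r²`: `DF(x) = 2⟪x, ·⟫`, as the value at `x` of the continuous linear
map `2 · innerSL`. [folklore] -/
theorem fderiv_norm_sq_sub (r : ℝ) :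
    fderiv ℝ (fun y : E => ‖y‖ ^ 2 - r ^ 2) =
      fun y => ((2 : ℝ) • (innerSL ℝ : E →L[ℝ] E →L[ℝ] ℝ)) y := by
  funext y
  have h1 : HasFDerivAt (fun y : E => ‖y‖ ^ 2 - r ^ 2) (2 • innerSL ℝ y) y :=
    (hasStrictFDerivAt_norm_sq y).hasFDerivAt.sub_const _
  rw [h1.fderiv]
  ext u
  change (2 : ℕ) • ((innerSL ℝ y : E →L[ℝ] ℝ) u) = (2 : ℝ) • (((innerSL ℝ : E →L[ℝ] E →L[ℝ] ℝ) y) u)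
  rw [innerSL_apply_apply, nsmul_eq_mul, smul_eq_mul, Nat.cast_ofNat]

/-- The gradient of `x ↦ ‖x‖² - r²` applied: `DF(x) v = 2 ⟪x, v⟫`. [folklore] -/
theorem fderiv_norm_sq_sub_apply (r : ℝ) (x v : E) :
    fderiv ℝ (fun y : E => ‖y‖ ^ 2 - r ^ 2) x v = 2 * ⟪x, v⟫_ℝ := by
  rw [fderiv_norm_sq_sub]
  rfl

/-- The Hessian of `x ↦ ‖x‖² - r²` is `2⟪·, ·⟫`: `D²F(x)[v, w] = 2 ⟪v, w⟫`. [folklore] -/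
theorem iteratedFDeriv_two_norm_sq_sub (r : ℝ) (x v w : E) :
    iteratedFDeriv ℝ 2 (fun y : E => ‖y‖ ^ 2 - r ^ 2) x ![v, w] = 2 * ⟪v, w⟫_ℝ := by
  rw [iteratedFDeriv_two_apply, fderiv_norm_sq_sub, ContinuousLinearMap.fderiv]
  rfl

/-- **The round sphere is `k`-convex for every `k ≥ 1`**: for `F = ‖·‖² - r²` and any orthonormal
`k`-frame, `Σᵢ D²F[vᵢ, vᵢ] = Σᵢ 2‖vᵢ‖² = 2k > 0` (all principal curvatures of the sphere of radius
`r` are `1/r > 0`). [folklore] -/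
theorem isKConvexLevelSet_norm_sq_sub {k : ℕ} (hk : 1 ≤ k) (r : ℝ) :
    IsKConvexLevelSet k (fun y : E => ‖y‖ ^ 2 - r ^ 2) := by
  intro x _ v hv _
  simp only [iteratedFDeriv_two_norm_sq_sub, real_inner_self_eq_norm_sq, hv.norm_eq_one, one_pow,
    mul_one, Finset.sum_const, Finset.card_univ, Fintype.card_fin, nsmul_eq_mul]
  have : (0 : ℝ) < k := by exact_mod_cast hk
  positivity

end Literature.Geometry.Riemannian
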